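import Summits.NavierStokesRegularity.FluidComputer.PalasekTowerFaceLayerAtEnvelope
import Summits.NavierStokesRegularity.NavierStokesRegularity.Theses.PalasekTowerBreakdown

/-!
# BC3 birth skeleton **v2** (FIVE-FACE cut) for crux `HeredityAtOneT` (stmt-NavierStokesRegularity-20304)
# of route `PalasekTowerBreakdown` (rev 19, re-based at `TowerRates.tuned = (2^24, 33/32, 12/5, 49/20)`)

Planner `ns-blowup-plan` (g23), 2026-08-27. Supersedes v1 (`BIRTH-20304-HeredityAtOneT-v1.lean`, sha16 0dae330c3157b765:
the coarse two-clause cut over LOCAL copies of `NoPrematureBreakdownGAt` / `HeredityOrBreakdownGAt`). v2 is stated over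
the TREE's R-generic face layer (fc-prover-2 g9: p527094 `PalasekTowerFaceLayerAt.lean` part I; part II
`PalasekTowerFaceLayerAtEnvelope.lean` with `heredityAtGAt_of_faces`, in tree 2026-08-27 ≈11:40Z) at `(R, k) = (TowerRates.tuned, 1)` — the exact tuned
twin of the wide v4 skeleton `Cruxes/HeredityAtOne/Lines/birth.lean` (5 named stubs; composition BY NAME).

* `stub_no_premature_breakdownT1 : NoPrematureBreakdownGAt tuned 1` — every pinned-rigid-quiet tuned design carrying a registered
  level-1 stage has a finite-energy classical continuation living to `τ₂` (HARDEST with the window ceiling: the two together are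
  `AprioriCeilingGAt tuned 1`, `aprioriCeilingGAt_iff_noPrematureBreakdown_and_windowCeiling`; local theory is NOT the issue —
  `localContinuationGAt_holds tuned 1` is a tree theorem).
* `stub_window_ceilingT1 : WindowCeilingGAt tuned 1` — the continuation obeys the cap `‖v‖ ≤ c₂·Y₂ = (5/3)·Y₂` on window 1.
* `stub_speed_floorT1 / stub_strain_floorT1 / stub_core_floorT1` — the three READOUTS at `τ₂` inside `‖x‖ ≤ S.radius`:
  speed `≥ c₁ Y₂`, gradient `≥ c₁ A₂`, a core loop of radius `1/N₂` with circulation `≥ c₁ N₂^{β−2}` (c₁ = 1 on `routeG`).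
* `HeredityAtOneT_of` — the kernel-checked composition concluding the ROUTE DECL
  `Summit.NavierStokesRegularity.NavierStokesRegularity.Theses.PalasekTowerBreakdown.HeredityAtOneT` BY NAME (the ONLY theorem of the
  file with that conclusion — skeleton-audit shape of DIRECTOR-NS #48 (4); the curried five-face implication is
  `heredityAtGAt_tuned_one_of_faces`, concluding the unfolded `HeredityAtGAt TowerRates.tuned 1`).

Standing kill currency (refuter4 K198 R1): ONE registered tuned design at level 1 whose quiet free run misses a level-2 floor
refutes the item as typed; the swirl-free axisymmetric class is the NAMED sterile instrument
(`PalasekTowerBreakdownNegative.palasekTowerBreakdown_not_heredity_pair_of_noSwirl_forced_design`, wide; STATUS 2026-08-27 11:19Z).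
Negative-modulo of record: p525716 `not_heredityAtGAt_of_subfloorStageGAt` (H = `SubfloorStageGAt tuned 1`, unconstructed).
LABEL: E–C typing skeleton; sorries ONLY inside `stub_*`. WHAT THIS IS NOT: not NS evidence; nothing inhabited.
-/

noncomputable section

namespace Summit.NavierStokesRegularity.FluidComputer.PalasekTowerClayBridge.BirthHeredityAtOneTv2

open Summit.NavierStokesRegularity.FluidComputer
open Summit.NavierStokesRegularity.FluidComputer.PalasekTowerClayBridge

/-- STUB 1 (hardest, with STUB 2): no premature breakdown on window 1 at the tuned rates. -/
theorem stub_no_premature_breakdownT1 : NoPrematureBreakdownGAt TowerRates.tuned 1 := by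
  sorry

/-- STUB 2: the window-1 speed ceiling `(5/3)·Y₂` for the finite-energy continuation. -/
theorem stub_window_ceilingT1 : WindowCeilingGAt TowerRates.tuned 1 := by
  sorry

/-- STUB 3: speed readout `≥ Y₂` at `τ₂` in the registered ball. -/
theorem stub_speed_floorT1 : SpeedFloorGAt TowerRates.tuned 1 := by
  sorry

/-- STUB 4: gradient readout `≥ A₂` at `τ₂` in the registered ball. -/
theorem stub_strain_floorT1 : StrainFloorGAt TowerRates.tuned 1 := by
  sorry

/-- STUB 5: core-loop circulation readout `≥ N₂^{β−2}` at `τ₂` in the registered ball. -/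
theorem stub_core_floorT1 : CoreFloorGAt TowerRates.tuned 1 := by
  sorry

/-- The curried implication (kernel-checked, no `sorry`): the five tuned level-1 faces ⇒ the crux's UNFOLDED tree statement
`HeredityAtGAt TowerRates.tuned 1`, via fc-prover-2's R-generic `heredityAtGAt_of_faces` (face layer part II). Not a skeleton
candidate (it does not conclude the route decl by name; the audit admits only registered heads as binders anyway — these five are
`@[conjecture]`-tagged tree Props, so either form would pass, but v2 keeps ONE candidate per file, uniformly with 20303/20305). -/
theorem heredityAtGAt_tuned_one_of_faces :
    NoPrematureBreakdownGAt TowerRates.tuned 1 → WindowCeilingGAt TowerRates.tuned 1 →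
    SpeedFloorGAt TowerRates.tuned 1 → StrainFloorGAt TowerRates.tuned 1 → CoreFloorGAt TowerRates.tuned 1 →
    HeredityAtGAt TowerRates.tuned 1 :=
  fun hN hW h₁ h₂ h₃ => heredityAtGAt_of_faces hN hW h₁ h₂ h₃

/-- **The skeleton (the ONLY theorem of this file concluding the route's crux `HeredityAtOneT` BY NAME)**: the crux assembled from
its five declared stubs (sorries live only in the five `stub_*`; decoration, not closure evidence). -/
theorem HeredityAtOneT_of :
    Summit.NavierStokesRegularity.NavierStokesRegularity.Theses.PalasekTowerBreakdown.HeredityAtOneT :=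
  heredityAtGAt_tuned_one_of_faces stub_no_premature_breakdownT1 stub_window_ceilingT1 stub_speed_floorT1
    stub_strain_floorT1 stub_core_floorT1

/-- Converse bookkeeping: the route decl is EQUIVALENT to the conjunction of its five faces (so no stub is decoration). -/
theorem HeredityAtOneT_iff_faces :
    Summit.NavierStokesRegularity.NavierStokesRegularity.Theses.PalasekTowerBreakdown.HeredityAtOneT ↔
      NoPrematureBreakdownGAt TowerRates.tuned 1 ∧ WindowCeilingGAt TowerRates.tuned 1 ∧
        SpeedFloorGAt TowerRates.tuned 1 ∧ StrainFloorGAt TowerRates.tuned 1 ∧ CoreFloorGAt TowerRates.tuned 1 :=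
  heredityAtGAt_iff_noPrematureBreakdown_windowCeiling_floors3 1

/-- The two hardest stubs are jointly the a-priori ceiling face at `(tuned, 1)` (local continuation is a tree theorem). -/
theorem stubs12_iff_aprioriCeilingT1 :
    NoPrematureBreakdownGAt TowerRates.tuned 1 ∧ WindowCeilingGAt TowerRates.tuned 1 ↔
      AprioriCeilingGAt TowerRates.tuned 1 :=
  (aprioriCeilingGAt_iff_noPrematureBreakdown_and_windowCeiling le_rfl).symm

/-- (C) already follows from the FAILURE of stub 1 (a premature breakdown at any rates is a Clay (C) witness). -/
theorem navierStokesBreakdownR3_of_not_stub1 (h : ¬ NoPrematureBreakdownGAt TowerRates.tuned 1) :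
    Summit.NavierStokesRegularity.NavierStokesRegularity.NavierStokesBreakdownR3 :=
  navierStokesBreakdownR3_of_not_noPrematureBreakdownGAt h

end Summit.NavierStokesRegularity.FluidComputer.PalasekTowerClayBridge.BirthHeredityAtOneTv2

end
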